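import Mathlib.RingTheory.MvPolynomial.Basic
import Mathlib.Algebra.MvPolynomial.CommRing
import Mathlib.RingTheory.Ideal.Span
import Mathlib.RingTheory.Ideal.Maps
import Mathlib.Algebra.BigOperators.Group.Finset.Basic
import HarnessLib

/-!
# Depth-3 syntactically multilinear (ΣΠΣ-multilinear) algebraic refutations modulo Boolean axioms

Definitions (real, with bodies; no named facts) of the weakest algebraic proof system in the
Ideal-Proof-System (IPS) landscape for which super-polynomial lower bounds on CNFs are the current
frontier: Nullstellensatz-form refutations `∑_a q_a · 𝒯_a ≡ 1 (mod ⟨X v ^ 2 - X v⟩)` whose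
coefficients `q_a` are given by DEPTH-3 SYNTACTICALLY MULTILINEAR formulas, i.e. sums of products of
affine forms, the affine forms inside one product having pairwise disjoint variable supports.

* Forbes–Shpilka–Tzameret–Wigderson, *Proof complexity lower bounds from algebraic circuit
  complexity*, Theory of Computing 17 (2021) (arXiv:1606.05050), §1.1 Definition 1.1–1.3: the
  systems `𝒞-IPS_LIN` / `𝒞-IPS_LIN'` — IPS certificates linear in the axiom placeholders, with the
  Boolean axioms `x_v ^ 2 - x_v` among the axioms, the certificate computed by a circuit from a
  restricted class `𝒞`; for `𝒞 = ΣΠ` formulas "`ΣΠ-IPS_LIN` is exactly the Nullstellensatz proof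
  system" (loc. cit.), and a `𝒞-IPS_LIN'` certificate `∑_a q_a · 𝒯_a + ∑_v h_v · (x_v^2 - x_v) = 1`
  is the same as the congruence `∑_a q_a 𝒯_a ≡ 1 (mod I_B)` below (the `h_v` are unconstrained).
* Raz–Yehudayoff, *Lower bounds and separations for constant depth multilinear circuits*,
  Comput. Complexity 18 (2009), §1–2: a formula is SYNTACTICALLY MULTILINEAR iff the two children of
  every product gate have disjoint variable sets; at product-depth one (ΣΠΣ) this says exactly that
  the affine forms of each product term have pairwise disjoint supports (`SigmaPiSigma.IsMultilinear`).

Contents: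
* `AffineForm σ K = (σ →₀ K) × K` — an affine form `∑_v c_v X v + c₀`, `AffineForm.toPoly`;
* `SigmaPiSigma σ K = List (List (AffineForm σ K))` — a ΣΠΣ formula as the list of its product
  terms, `SigmaPiSigma.toPoly = ∑_t ∏_{ℓ ∈ t} ℓ`, `SigmaPiSigma.size` = the number of product terms
  (top fan-in; the size measure of loc. cit. and of the depth-3 multilinear lower-bound literature up
  to the polynomial factor "number of affine forms"), `SigmaPiSigma.IsMultilinear`;
* `booleanIdeal σ K = ⟨X v ^ 2 - X v : v⟩` — the Boolean ideal `I_B`;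
* `HasMLSigmaPiSigmaRefutation 𝒯 s` — the finite family `𝒯 : ι → K[σ]` has a ΣΠΣ-multilinear
  Nullstellensatz refutation modulo Boolean axioms of total size `≤ s`: multilinear ΣΠΣ formulas
  `q_a` with `∑_a size (q_a) ≤ s` and `∑_a q_a · 𝒯_a - 1 ∈ I_B`.

API (proved): unfolding lemmas, monotonicity in `s`, `I_B` vanishes at Boolean points
(`eval_eq_zero_of_mem_booleanIdeal`) and SOUNDNESS (`HasMLSigmaPiSigmaRefutation.not_of_common_boolean_zero`:
a family with a common Boolean zero has no refutation). NOT here: completeness (every family without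
common Boolean zero over a finite `σ` has one, of size `≤ |ι| · 2^|σ|`), general IPS, roABP-IPS,
higher product-depth.

## References

* M. A. Forbes, A. Shpilka, I. Tzameret, A. Wigderson, *Proof complexity lower bounds from
  algebraic circuit complexity*, Theory Comput. 17 (2021), arXiv:1606.05050, §1.1.
  [ForbesShpilkaTzameretWigderson2021]
* R. Raz, A. Yehudayoff, *Lower bounds and separations for constant depth multilinear circuits*,
  Comput. Complexity 18 (2009) 171–207, §2. [RazYehudayoff2008]
* J. A. Grochow, T. Pitassi, *Circuit complexity, proof complexity, and polynomial identity
  testing: the ideal proof system*, J. ACM 65 (2018), §1. [GrochowPitassi2018]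
-/

noncomputable section

open MvPolynomial
open scoped BigOperators

namespace Literature.Computability.MetaComplexity

universe u v

/-! ### ΣΠΣ formulas -/

/-- An affine form `∑_v c_v · X v + c₀` over the variables `σ`: a finitely supported coefficient
vector and a constant term. [cite: RazYehudayoff2008, §2] -/
abbrev AffineForm (σ : Type u) (K : Type v) [CommRing K] : Type max u v :=
  (σ →₀ K) × K

variable {σ : Type u} {K : Type v} [CommRing K]

/-- The polynomial `∑_v c_v X v + C c₀` of an affine form. [cite: RazYehudayoff2008, §2] -/
def AffineForm.toPoly (ℓ : AffineForm σ K) : MvPolynomial σ K :=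
  ℓ.1.sum (fun v a => C a * X v) + C ℓ.2

variable (σ K) in
/-- A depth-3 `ΣΠΣ` formula, presented as the list of its product terms, each product term being
the list of its affine factors. [cite: RazYehudayoff2008, §1] -/
abbrev SigmaPiSigma : Type max u v :=
  List (List (AffineForm σ K))

/-- The polynomial computed by a product term: the product of its affine factors (`1` for the empty
term). [cite: RazYehudayoff2008, §1] -/
def SigmaPiSigma.termPoly (t : List (AffineForm σ K)) : MvPolynomial σ K :=
  (t.map AffineForm.toPoly).prod

/-- The polynomial computed by a `ΣΠΣ` formula: the sum of its product terms.
[cite: RazYehudayoff2008, §1] -/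
def SigmaPiSigma.toPoly (F : SigmaPiSigma σ K) : MvPolynomial σ K :=
  (F.map SigmaPiSigma.termPoly).sum

/-- The SIZE of a `ΣΠΣ` formula in the sense of the depth-3 multilinear refutation literature: its
number of product terms (top fan-in). [cite: ForbesShpilkaTzameretWigderson2021, §1.1] -/
def SigmaPiSigma.size (F : SigmaPiSigma σ K) : ℕ :=
  F.length

/-- A `ΣΠΣ` formula is SYNTACTICALLY MULTILINEAR when the affine factors of each of its product
terms have pairwise disjoint variable supports (Raz–Yehudayoff: the children of every product gate
have disjoint variable sets). [cite: RazYehudayoff2008, §2] -/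
def SigmaPiSigma.IsMultilinear (F : SigmaPiSigma σ K) : Prop :=
  ∀ t ∈ F, t.Pairwise fun ℓ ℓ' => Disjoint ℓ.1.support ℓ'.1.support

/-! ### The Boolean ideal and refutations -/

variable (σ K) in
/-- The Boolean ideal `I_B = ⟨X v ^ 2 - X v : v ∈ σ⟩` of `K[σ]`.
[cite: ForbesShpilkaTzameretWigderson2021, §1.1] -/
def booleanIdeal : Ideal (MvPolynomial σ K) :=
  Ideal.span (Set.range fun v : σ => (X v ^ 2 - X v : MvPolynomial σ K))

/-- `HasMLSigmaPiSigmaRefutation 𝒯 s`: the finite family of polynomials `𝒯` has a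
`ΣΠΣ`-MULTILINEAR NULLSTELLENSATZ REFUTATION MODULO BOOLEAN AXIOMS of total size at most `s` —
syntactically multilinear `ΣΠΣ` formulas `q a`, with at most `s` product terms in total, such that
`∑_a q_a · 𝒯_a ≡ 1 (mod I_B)` (equivalently: a `ΣΠΣ`-multilinear `IPS_LIN'` certificate in the sense
of Forbes–Shpilka–Tzameret–Wigderson with unconstrained Boolean-axiom coefficients).
[cite: ForbesShpilkaTzameretWigderson2021, §1.1 Definition 1.1] -/
def HasMLSigmaPiSigmaRefutation {ι : Type*} [Fintype ι] (𝒯 : ι → MvPolynomial σ K) (s : ℕ) :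
    Prop :=
  ∃ q : ι → SigmaPiSigma σ K, (∀ a, (q a).IsMultilinear) ∧ ∑ a, (q a).size ≤ s ∧
    (∑ a, (q a).toPoly * 𝒯 a) - 1 ∈ booleanIdeal σ K

/-! ### API -/

/-- The empty formula computes `0`. [folklore] -/
@[simp] theorem SigmaPiSigma.toPoly_nil : SigmaPiSigma.toPoly ([] : SigmaPiSigma σ K) = 0 := rfl

/-- Unfolding `toPoly` on a cons. [folklore] -/
@[simp] theorem SigmaPiSigma.toPoly_cons (t : List (AffineForm σ K)) (F : SigmaPiSigma σ K) :
    SigmaPiSigma.toPoly (t :: F) = SigmaPiSigma.termPoly t + SigmaPiSigma.toPoly F := by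
  simp [SigmaPiSigma.toPoly]

/-- The empty product term computes `1`. [folklore] -/
@[simp] theorem SigmaPiSigma.termPoly_nil :
    SigmaPiSigma.termPoly ([] : List (AffineForm σ K)) = 1 := rfl

/-- Unfolding `termPoly` on a cons. [folklore] -/
@[simp] theorem SigmaPiSigma.termPoly_cons (ℓ : AffineForm σ K) (t : List (AffineForm σ K)) :
    SigmaPiSigma.termPoly (ℓ :: t) = ℓ.toPoly * SigmaPiSigma.termPoly t := by
  simp [SigmaPiSigma.termPoly]

/-- The size of the empty formula is `0` and of a cons is one more. [folklore] -/
@[simp] theorem SigmaPiSigma.size_nil : SigmaPiSigma.size ([] : SigmaPiSigma σ K) = 0 := rfl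

/-- See `SigmaPiSigma.size_nil`. [folklore] -/
@[simp] theorem SigmaPiSigma.size_cons (t : List (AffineForm σ K)) (F : SigmaPiSigma σ K) :
    SigmaPiSigma.size (t :: F) = F.size + 1 := rfl

/-- The empty formula is (vacuously) multilinear. [folklore] -/
theorem SigmaPiSigma.isMultilinear_nil : SigmaPiSigma.IsMultilinear ([] : SigmaPiSigma σ K) :=
  fun _ h => by simp at h

/-- The constant affine form `c₀` computes `C c₀`. [folklore] -/
@[simp] theorem AffineForm.toPoly_zero_fst (c : K) :
    AffineForm.toPoly ((0, c) : AffineForm σ K) = C c := by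
  simp [AffineForm.toPoly]

/-- Monotonicity of the size bound. [folklore] -/
theorem HasMLSigmaPiSigmaRefutation.mono {ι : Type*} [Fintype ι] {𝒯 : ι → MvPolynomial σ K}
    {s s' : ℕ} (h : HasMLSigmaPiSigmaRefutation 𝒯 s) (hs : s ≤ s') :
    HasMLSigmaPiSigmaRefutation 𝒯 s' := by
  obtain ⟨q, hml, hsize, hid⟩ := h
  exact ⟨q, hml, hsize.trans hs, hid⟩

/-- The Boolean ideal vanishes at every Boolean point of `K^σ`.
[cite: ForbesShpilkaTzameretWigderson2021, §1.1] -/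
theorem eval_eq_zero_of_mem_booleanIdeal {x : σ → K} (hx : ∀ v, x v = 0 ∨ x v = 1)
    {p : MvPolynomial σ K} (hp : p ∈ booleanIdeal σ K) : MvPolynomial.eval x p = 0 := by
  have hle : booleanIdeal σ K ≤ RingHom.ker (MvPolynomial.eval x) := by
    refine Ideal.span_le.2 ?_
    rintro _ ⟨v, rfl⟩
    rcases hx v with h | h <;> simp [RingHom.mem_ker, h]
  exact (RingHom.mem_ker).1 (hle hp)

/-- SOUNDNESS: a family of polynomials with a common Boolean zero has no ΣΠΣ-multilinear
Nullstellensatz refutation modulo Boolean axioms (evaluate the congruence at the zero: `0 - 1 = 0`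
in a nontrivial ring). [cite: ForbesShpilkaTzameretWigderson2021, §1.1] -/
theorem HasMLSigmaPiSigmaRefutation.not_of_common_boolean_zero [Nontrivial K] {ι : Type*}
    [Fintype ι] {𝒯 : ι → MvPolynomial σ K} {x : σ → K} (hx : ∀ v, x v = 0 ∨ x v = 1)
    (h0 : ∀ a, MvPolynomial.eval x (𝒯 a) = 0) (s : ℕ) : ¬ HasMLSigmaPiSigmaRefutation 𝒯 s := by
  rintro ⟨q, -, -, hid⟩
  have h1 := eval_eq_zero_of_mem_booleanIdeal hx hid
  simp [map_sum, map_mul, h0] at h1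

end Literature.Computability.MetaComplexity
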